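import Summits.BirchSwinnertonDyer.BirchSwinnertonDyer.Theses.PrintCFram
import Summits.BirchSwinnertonDyer.Rank1Residual.X12.O11.RamifiedStrictDescentAtThreeLeaf
import HarnessLib

/-!
# Route `PrintCFram`, regime N `TorsionFreeFrameBSDThree` (item stmt-BirchSwinnertonDyer-20698):
# the DISCHARGE INTERFACE — regime N is EXACTLY the elliptic-unit index law (R-EU)₃ on regime N,
# BY NAME, modulo {modularity, Gross–Zagier I.(7.3), GZK, Cassels}
# (cell `bsd-print-cfram`, D-0131 (2) print tier, seat ty2 gen 2 = the cell's discharge-interface typer)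

HONEST FRAMING (cell `bsd-print-cfram`, HOME `run/shared/lean/pub/bsd-print-cfram/`): THEOREMS ONLY
(no definition, no named fact, no axiom, no `sorry`); nothing about BSD is booked; regime N (and the
leaf `Summit.BirchSwinnertonDyer.WAllCornerFRamifiedAtThree`) stays OPEN; 0 cells move;
beyond-print theorem: NO. Regime N of the gen-1 split of C1 (route rev 6) reads: granted the four
refereed facts, `BSDp W 3` for every globally minimal `W/ℚ` at every analytic-rank-one `3`-frame
`X12.O11.IsFrameThree W K 𝔭 W' C` (`K = ℚ(√−3)`, `𝔭 ∋ 3`, `W' = C • W^{(−3)}` globally minimal)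
whose two DISPLAYED local inputs hold — (A𝔭)₃: no non-zero `ℚ₃`-rational `3`-torsion on `W` and on
`W'`; (Av)₃: at every degree-one place `v ∤ 3` of `K`, good reduction or no non-zero `K_v`-rational
`3`-torsion. Its named residual is (R-EU)₃ = `X12.O11.RamifiedCMEllipticUnitIndexAtThree W` (ty2 gen 1,
`X12/O11/RamifiedStrictDescentAtThree.lean`; Perrin-Riou's leading-term law for the CM zeta element at
the ramified prime `3` — NOT in print: BKNO 2026 is `p ≥ 5` / §1.4 «report elsewhere», Rubin 1991
Thm. 4.1 excludes `p ∣ #𝒪_K^×`, Johnson-Leung–Kings 2011 Thm. 5.2 is the rational statement).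

WHAT IS NEW (relative to ty2 gen 1's companions, which build their OWN frame from GZK and phrase the
away input over `ℚ_ℓ`): the item N quantifies over an ARBITRARY frame `(K, 𝔭, W', C)` and phrases
(A𝔭)₃/(Av)₃ on that frame's `W'` and `K`. §1 supplies the frame data (anticyclotomic `ℤ₃`-tower of
THAT `K` with a topological generator; Mordell–Weil generators of `W`, `W'` modulo torsion with their
exact `3`-divisibility levels) for a GIVEN frame from GZK, so that
`X12.O11.bsdp_three_of_ramifiedCMEllipticUnitIndexAtThree` applies with the item's own binders:
* §1 `bsdp_three_of_indexLawAtThree_of_isFrameThree` — at a given rank-one `3`-frame with (A𝔭)₃,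
  (Av)₃: (R-EU)₃ at `W` + the four facts ⟹ `BSDp W 3`.
* §2 `torsionFreeFrameBSDThree_of_indexLawAtThree` — **N ⟸ the class-wide law
  `∀ W, HasCM → r_an = 1 → CMRamified W 3 → (R-EU)₃ W`** (the planner's child «E» of ty2 gen 1's
  TURNKEY), conclusion = the route declaration BY NAME; and the sharper
  `torsionFreeFrameBSDThree_of_indexLawOnRegimeN` — N ⟸ (R-EU)₃ demanded ONLY on regime N (same
  binders as N, facts as antecedents).
* §3 `indexLawOnRegimeN_of_torsionFreeFrameBSDThree` (converse, via gen 1's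
  `ramifiedCMEllipticUnitIndexAtThree_of_bsdp`: no local clause needed) and
  **`torsionFreeFrameBSDThree_iff_indexLawOnRegimeN` — regime N ⟺ (R-EU)₃ on regime N**: the item's
  residual identified EXACTLY in the kernel (no strengthening, no weakening).
Every binder of N is consumed verbatim; every hypothesis of the consumed X12.O11 theorems is displayed.

References: route file `Theses/PrintCFram.lean` rev 6 (items 20698–20701); HOME/TY2-DISCHARGE-TABLE.md §C;
ty2 gen 1 files `X12/O11/RamifiedStrictDescentAtThree{,Local,Discharge,Leaf}.lean` (p539796, p541218,
p541823, p543426, p545561); [cite: Miller2011LMS, §1 and Def. 1.1 (arXiv:1010.2431 p. 3) (`BSDp`)];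
[cite: GrossZagier1986, Thm. I.(7.3)]; [cite: Cassels1965ArithmeticVIII]; [cite: Darmon2004, Thm. 3.22
and §3.9 (GZK)]; [cite: Washington1997, Thm. 13.4 (`ℤ_p`-rank of an imaginary quadratic field = 2; the
anticyclotomic line)]; [cite: BurungaleKobayashiNakamuraOta2026, §1.4 (arXiv:2608.06879 p. 8) (claim;
preprint; shape of (R-EU) only; `p ≥ 5` there)]; [cite: GreenbergLNM1716, §3 Lemma 3.3 (the print
behind (Av)₃)].
-/

set_option autoImplicit false

noncomputable section

open scoped Classical

open WeierstrassCurve NumberField IsDedekindDomain Field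
  Literature.NumberTheory.EllipticCurves
  Literature.NumberTheory.EllipticCurves.Rank1Residual
  Literature.NumberTheory.GaloisRepresentations
  Summit.BirchSwinnertonDyer.Rank1Residual
  Summit.BirchSwinnertonDyer.Rank1Residual.X12.O11
  Summit.BirchSwinnertonDyer.BirchSwinnertonDyer.Theorems
  Summit.BirchSwinnertonDyer.BirchSwinnertonDyer.Theses.PrintCFram

namespace Summit.BirchSwinnertonDyer.Rank1Residual.PrintCfram

/-! ## §1 Frame level: (R-EU)₃ at `W` ⟹ `BSD(W, 3)` at a GIVEN rank-one `3`-frame on regime N -/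

section Frame

variable {W : WeierstrassCurve ℚ} [W.IsElliptic] [W.IsGloballyMinimal]
  {K : Type} [Field K] [NumberField K] {𝔭 : HeightOneSpectrum (𝓞 K)}
  {W' : WeierstrassCurve ℚ} [W'.IsElliptic] [W'.IsGloballyMinimal] {C : VariableChange ℚ}

/-- **(R-EU)₃ at `W` ⟹ `BSD(W, 3)` at a GIVEN analytic-rank-one `3`-frame `(K, 𝔭, W', C)` on regime
N**, granted modularity (`hmod`), Gross–Zagier I.(7.3) (`hGZ`), GZK (`hGZK`) and Cassels (`hCassels`).
The frame data demanded by `X12.O11.bsdp_three_of_ramifiedCMEllipticUnitIndexAtThree` is produced for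
THIS frame: the anticyclotomic `ℤ₃`-extension of the frame field `K` (imaginary quadratic, `hF.2.2.1`)
with a topological generator (`ZpExtension.exists_isAnticyclotomic_holds`, `exists_isTopGenerator` —
unconditional tree theorems), and Mordell–Weil generators of `W` and of `W'` modulo torsion with their
exact `3`-divisibility levels in `E(ℚ₃)` (`RamifiedSevenEllipticUnits.exists_generator_with_level`;
rank one for `W` by GZK and for `W'` by isogeny invariance of the analytic rank,
`isIsogenous_of_isFrameThree`). The two local inputs (A𝔭)₃ (`htors`, `htors'`) and (Av)₃ (`hv`) are
the item's binders, passed verbatim. CONDITIONAL on (R-EU)₃ at `W` (`h3`); nothing booked.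
[cite: Miller2011LMS, §1 and Def. 1.1 (arXiv:1010.2431 p. 3)] [cite: Darmon2004, Thm. 3.22 and §3.9]
[cite: Washington1997, Thm. 13.4] [cite: GrossZagier1986, Thm. I.(7.3)] [cite: Cassels1965ArithmeticVIII] -/
theorem bsdp_three_of_indexLawAtThree_of_isFrameThree (hmod : hasEntireLFunction_rat)
    (hGZ : GrossZagier1986_thm_I_7_3) (hGZK : rank_eq_analyticRank_of_analyticRank_le_one)
    (hCassels : bsdRHS_eq_of_isIsogenous) (hF : IsFrameThree W K 𝔭 W' C) (hr : W.analyticRank = 1)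
    (htors : ∀ Q : (W.baseChange ℚ_[3]).toAffine.Point, (3 : ℕ) • Q = 0 → Q = 0)
    (htors' : ∀ Q : (W'.baseChange ℚ_[3]).toAffine.Point, (3 : ℕ) • Q = 0 → Q = 0)
    (hv : ∀ v : HeightOneSpectrum (𝓞 K), ((3 : ℕ) : 𝓞 K) ∉ v.asIdeal →
      v.asIdeal.ramificationIdx (𝓞 ℚ) = 1 → v.asIdeal.inertiaDeg (𝓞 ℚ) = 1 →
      (W.baseChange K).HasGoodReductionAt v ∨
        ∀ R : ((W.baseChange K).baseChange (v.adicCompletion K)).toAffine.Point,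
          (3 : ℕ) • R = 0 → R = 0)
    (h3 : RamifiedCMEllipticUnitIndexAtThree W) : BSDp W 3 := by
  have hK : IsImaginaryQuadratic K := hF.2.2.1
  have hiso : IsIsogenous W W' := isIsogenous_of_isFrameThree hF
  -- the anticyclotomic `ℤ₃`-extension of THIS frame field and a topological generator
  obtain ⟨κ, hκ⟩ := ZpExtension.exists_isAnticyclotomic_holds (K := K) (p := 3) hK.1
    (fun w => hK.2.isComplex w)
  obtain ⟨γ, hγ⟩ := κ.exists_isTopGenerator
  haveI : Fact (κ.IsTopGenerator γ) := ⟨hγ⟩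
  -- Mordell–Weil generators with their `3`-divisibility levels for `W` and `W'` (rank one by GZK)
  have hrank : W.mordellWeilRank = 1 := by rw [(hGZK W hr.le).1, hr]
  have hr' : W'.analyticRank = 1 := by rw [← analyticRank_eq_of_isIsogenous' hiso, hr]
  have hrank' : W'.mordellWeilRank = 1 := by rw [(hGZK W' hr'.le).1, hr']
  obtain ⟨P, n, hP, hgen, hdiv, hndiv⟩ :=
    RamifiedSevenEllipticUnits.exists_generator_with_level W 3 hrank
  obtain ⟨P', n', hP', hgen', hdiv', hndiv'⟩ :=
    RamifiedSevenEllipticUnits.exists_generator_with_level W' 3 hrank'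
  exact bsdp_three_of_ramifiedCMEllipticUnitIndexAtThree hmod hGZ hGZK hCassels h3 hF hr hκ γ hP hgen
    htors hdiv hndiv hP' hgen' htors' hdiv' hndiv' hv

omit [W'.IsElliptic] [W'.IsGloballyMinimal] in
/-- **`BSD(W, 3)` ⟹ (R-EU)₃ at `W`** at any `3`-frame of analytic rank one, granted Cassels,
modularity and GZK — ty2 gen 1's `ramifiedCMEllipticUnitIndexAtThree_of_bsdp` (no local clause is
needed in this direction; the frame only witnesses that the statement is not vacuous).
[cite: Cassels1965ArithmeticVIII] [cite: Miller2011LMS, Def. 1.1 (arXiv:1010.2431 p. 3)] -/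
theorem indexLawAtThree_of_bsdp_of_isFrameThree (hCassels : bsdRHS_eq_of_isIsogenous)
    (hmod : hasEntireLFunction_rat) (hGZK : rank_eq_analyticRank_of_analyticRank_le_one)
    (_hF : IsFrameThree W K 𝔭 W' C) (hr : W.analyticRank = 1) (hB : BSDp W 3) :
    RamifiedCMEllipticUnitIndexAtThree W :=
  ramifiedCMEllipticUnitIndexAtThree_of_bsdp hCassels hmod hGZK hr.le hB

end Frame

/-! ## §2 Item level: regime N `TorsionFreeFrameBSDThree` BY NAME from the index law -/

/-- **Regime N ⟸ the class-wide elliptic-unit index law at `3`.** If (R-EU)₃ holds at every globally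
minimal CM curve of analytic rank one with `3` ramified in its CM field (the O11@3 residual «E» of
ty2 gen 1's TURNKEY; vacuous off regime N by its own binders), then the route declaration
`Theses.PrintCFram.TorsionFreeFrameBSDThree` (item stmt-BirchSwinnertonDyer-20698) holds: at a frame,
`W.HasCM` and `CMRamified W 3` are `hF.1`, `hF.2.1`, and §1 applies with the item's own binders.
CONDITIONAL on `hE`; the type of the conclusion is literally the route declaration.
[cite: Miller2011LMS, §1 and Def. 1.1 (arXiv:1010.2431 p. 3)] -/
theorem torsionFreeFrameBSDThree_of_indexLawAtThree
    (hE : ∀ (W : WeierstrassCurve ℚ) [W.IsElliptic] [W.IsGloballyMinimal],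
      W.HasCM → W.analyticRank = 1 → CMRamified W 3 → RamifiedCMEllipticUnitIndexAtThree W) :
    Summit.BirchSwinnertonDyer.BirchSwinnertonDyer.Theses.PrintCFram.TorsionFreeFrameBSDThree :=
  fun hmod hGZ hGZK hCassels W _ _ _K _ _ _𝔭 _W' _ _ _C hF hr htors htors' hv =>
    bsdp_three_of_indexLawAtThree_of_isFrameThree hmod hGZ hGZK hCassels hF hr htors htors' hv
      (hE W hF.1 hr hF.2.1)

/-- **Regime N ⟸ (R-EU)₃ demanded on regime N only** (same binders as the item, the four facts as
antecedents): the sharpest sufficient input. CONDITIONAL on `hEN`; conclusion = the route declaration.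
[cite: Miller2011LMS, §1 and Def. 1.1 (arXiv:1010.2431 p. 3)] -/
theorem torsionFreeFrameBSDThree_of_indexLawOnRegimeN
    (hEN : hasEntireLFunction_rat → GrossZagier1986_thm_I_7_3 →
      rank_eq_analyticRank_of_analyticRank_le_one → bsdRHS_eq_of_isIsogenous →
      ∀ (W : WeierstrassCurve ℚ) [W.IsElliptic] [W.IsGloballyMinimal] (K : Type) [Field K]
        [NumberField K] (𝔭 : HeightOneSpectrum (𝓞 K)) (W' : WeierstrassCurve ℚ) [W'.IsElliptic]
        [W'.IsGloballyMinimal] (C : VariableChange ℚ),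
        IsFrameThree W K 𝔭 W' C → W.analyticRank = 1 →
        (∀ Q : (W.baseChange ℚ_[3]).toAffine.Point, (3 : ℕ) • Q = 0 → Q = 0) →
        (∀ Q : (W'.baseChange ℚ_[3]).toAffine.Point, (3 : ℕ) • Q = 0 → Q = 0) →
        (∀ v : HeightOneSpectrum (𝓞 K), ((3 : ℕ) : 𝓞 K) ∉ v.asIdeal →
          v.asIdeal.ramificationIdx (𝓞 ℚ) = 1 → v.asIdeal.inertiaDeg (𝓞 ℚ) = 1 →
          (W.baseChange K).HasGoodReductionAt v ∨
            ∀ R : ((W.baseChange K).baseChange (v.adicCompletion K)).toAffine.Point,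
              (3 : ℕ) • R = 0 → R = 0) →
        RamifiedCMEllipticUnitIndexAtThree W) :
    Summit.BirchSwinnertonDyer.BirchSwinnertonDyer.Theses.PrintCFram.TorsionFreeFrameBSDThree :=
  fun hmod hGZ hGZK hCassels W _ _ K _ _ 𝔭 W' _ _ C hF hr htors htors' hv =>
    bsdp_three_of_indexLawAtThree_of_isFrameThree hmod hGZ hGZK hCassels hF hr htors htors' hv
      (hEN hmod hGZ hGZK hCassels W K 𝔭 W' C hF hr htors htors' hv)

/-! ## §3 Converse and the equivalence: regime N ⟺ (R-EU)₃ on regime N -/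

/-- **Regime N ⟹ (R-EU)₃ on regime N** (facts as antecedents; the local binders are accepted and not
used: `BSD(W, 3) ⟹ (R-EU)₃ W` needs none, `ramifiedCMEllipticUnitIndexAtThree_of_bsdp`).
[cite: Cassels1965ArithmeticVIII] [cite: Miller2011LMS, Def. 1.1 (arXiv:1010.2431 p. 3)] -/
theorem indexLawOnRegimeN_of_torsionFreeFrameBSDThree
    (hN : Summit.BirchSwinnertonDyer.BirchSwinnertonDyer.Theses.PrintCFram.TorsionFreeFrameBSDThree) :
    hasEntireLFunction_rat → GrossZagier1986_thm_I_7_3 →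
      rank_eq_analyticRank_of_analyticRank_le_one → bsdRHS_eq_of_isIsogenous →
      ∀ (W : WeierstrassCurve ℚ) [W.IsElliptic] [W.IsGloballyMinimal] (K : Type) [Field K]
        [NumberField K] (𝔭 : HeightOneSpectrum (𝓞 K)) (W' : WeierstrassCurve ℚ) [W'.IsElliptic]
        [W'.IsGloballyMinimal] (C : VariableChange ℚ),
        IsFrameThree W K 𝔭 W' C → W.analyticRank = 1 →
        (∀ Q : (W.baseChange ℚ_[3]).toAffine.Point, (3 : ℕ) • Q = 0 → Q = 0) →
        (∀ Q : (W'.baseChange ℚ_[3]).toAffine.Point, (3 : ℕ) • Q = 0 → Q = 0) →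
        (∀ v : HeightOneSpectrum (𝓞 K), ((3 : ℕ) : 𝓞 K) ∉ v.asIdeal →
          v.asIdeal.ramificationIdx (𝓞 ℚ) = 1 → v.asIdeal.inertiaDeg (𝓞 ℚ) = 1 →
          (W.baseChange K).HasGoodReductionAt v ∨
            ∀ R : ((W.baseChange K).baseChange (v.adicCompletion K)).toAffine.Point,
              (3 : ℕ) • R = 0 → R = 0) →
        RamifiedCMEllipticUnitIndexAtThree W :=
  fun hmod hGZ hGZK hCassels W _ _ K _ _ 𝔭 W' _ _ C hF hr htors htors' hv =>
    ramifiedCMEllipticUnitIndexAtThree_of_bsdp hCassels hmod hGZK hr.le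
      (hN hmod hGZ hGZK hCassels W K 𝔭 W' C hF hr htors htors' hv)

/-- **Regime N ⟺ (R-EU)₃ on regime N.** The item `TorsionFreeFrameBSDThree`
(stmt-BirchSwinnertonDyer-20698) is EQUIVALENT, in the kernel, to the elliptic-unit index law (R-EU)₃
demanded at every analytic-rank-one `3`-frame satisfying (A𝔭)₃ and (Av)₃, each side with the four
refereed facts as antecedents: the named residual of regime N is identified EXACTLY (its content is
Perrin-Riou's leading-term law for the CM zeta element at the ramified prime `3` — CONSTRUCTION / OPEN,
not in print; nothing is asserted about it here).
[cite: Miller2011LMS, §1 and Def. 1.1 (arXiv:1010.2431 p. 3)]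
[cite: BurungaleKobayashiNakamuraOta2026, §1.4 (arXiv:2608.06879 p. 8) (claim; preprint; shape only; `p ≥ 5` there)] -/
theorem torsionFreeFrameBSDThree_iff_indexLawOnRegimeN :
    Summit.BirchSwinnertonDyer.BirchSwinnertonDyer.Theses.PrintCFram.TorsionFreeFrameBSDThree ↔
      (hasEntireLFunction_rat → GrossZagier1986_thm_I_7_3 →
        rank_eq_analyticRank_of_analyticRank_le_one → bsdRHS_eq_of_isIsogenous →
        ∀ (W : WeierstrassCurve ℚ) [W.IsElliptic] [W.IsGloballyMinimal] (K : Type) [Field K]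
          [NumberField K] (𝔭 : HeightOneSpectrum (𝓞 K)) (W' : WeierstrassCurve ℚ) [W'.IsElliptic]
          [W'.IsGloballyMinimal] (C : VariableChange ℚ),
          IsFrameThree W K 𝔭 W' C → W.analyticRank = 1 →
          (∀ Q : (W.baseChange ℚ_[3]).toAffine.Point, (3 : ℕ) • Q = 0 → Q = 0) →
          (∀ Q : (W'.baseChange ℚ_[3]).toAffine.Point, (3 : ℕ) • Q = 0 → Q = 0) →
          (∀ v : HeightOneSpectrum (𝓞 K), ((3 : ℕ) : 𝓞 K) ∉ v.asIdeal →
            v.asIdeal.ramificationIdx (𝓞 ℚ) = 1 → v.asIdeal.inertiaDeg (𝓞 ℚ) = 1 →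
            (W.baseChange K).HasGoodReductionAt v ∨
              ∀ R : ((W.baseChange K).baseChange (v.adicCompletion K)).toAffine.Point,
                (3 : ℕ) • R = 0 → R = 0) →
          RamifiedCMEllipticUnitIndexAtThree W) :=
  ⟨indexLawOnRegimeN_of_torsionFreeFrameBSDThree, torsionFreeFrameBSDThree_of_indexLawOnRegimeN⟩

end Summit.BirchSwinnertonDyer.Rank1Residual.PrintCfram

end
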